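import Summits.HubbardSuperconductivity.HubbardSuperconductivity.Theorems.AnisotropyChordStiffnessDoobLoops
import Mathlib.Logic.Equiv.Fin.Rotate

/-!
# Route `AnisotropyChord` / H0 rotor rung: DEFECT WINDING CYCLES are simple winding loops of the Doob configuration
# network — stubs (L1), (L2) of the converse rung N⁻ (theory seat `hubbard-h0-rotor-theory-1`, cycle 10, memo
# ROTOR-THEORY-10 §141, §143 work-order v9)

Part A (`…Stiffness.Loop`): a cyclic walk `edge : Fin n → E` carries the multiplicity weight `walkWeight` — a
circulation (`isCirculation_walkWeight`), `≤ 1` when injective, `drive = Σ_t s(edge t)`, `resistance = Σ_t 1/c(edge t)`.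
Part B: `DefectCycle L j` = background `base` + injective closed n.n. walk `site : Fin n → (ℤ/L)²` through EMPTY sites
of `base`, winding once along axis `j`; the defect travelling around it is a cyclic walk of hop-edges through the
single-defect TELEPORTS `base ∪ {site t}` (`hopTgt_edge`).  (L1): `loop_isCirculation`, `loop_le_one`, `loop_cond_pos`,
`drive_loop_sq_ge`, `resistance_loop(_pos)`, `sq_mul_resistance_loop_le` (average flatness ⇒ `a(σ)²R ≤ 4nB²`);
(L2): `mover_edge`, `base_eq_of_edge` (a hop-edge determines defect site and background).  Families and the fixed-`L`
floor: `…StiffnessDoobDefectLoops`.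
-/

set_option linter.dupNamespace false

noncomputable section

open Matrix Complex Finset Filter Topology
open Literature.MathematicalPhysics.QuantumLattice hiding torusPhase torusNorm
open Literature.Probability.LatticeModels

/-! ## Part A — cyclic walks are circulations (abstract network) -/
namespace Summit.HubbardSuperconductivity.HubbardSuperconductivity.Theorems.AnisotropyChord.Stiffness.Loop

variable {V E : Type*} [Fintype E] [DecidableEq E]

/-- Multiplicity weight of a finite edge sequence: `m(e) = #{t : edge t = e}`. [folklore] -/
def walkWeight {n : ℕ} (edge : Fin n → E) (e : E) : ℝ := ((univ.filter fun t => edge t = e).card : ℝ)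

omit [Fintype E] in
/-- `m(e) = Σ_t [edge t = e]`. [folklore] -/
theorem walkWeight_eq_sum {n : ℕ} (edge : Fin n → E) (e : E) :
    walkWeight edge e = ∑ t, if edge t = e then (1 : ℝ) else 0 := by
  unfold walkWeight
  rw [Finset.card_filter]
  push_cast
  rfl

omit [Fintype E] in
/-- `m ≥ 0`. [folklore] -/
theorem walkWeight_nonneg {n : ℕ} (edge : Fin n → E) (e : E) : 0 ≤ walkWeight edge e := by unfold walkWeight; positivity

/-- Pairing the multiplicity weight with an edge function re-sums along the walk:
`Σ_e m(e) f(e) = Σ_t f(edge t)`. [folklore] -/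
theorem sum_walkWeight_mul {n : ℕ} (edge : Fin n → E) (f : E → ℝ) :
    ∑ e, walkWeight edge e * f e = ∑ t, f (edge t) := by
  simp_rw [walkWeight_eq_sum, Finset.sum_mul]
  rw [Finset.sum_comm]
  refine Finset.sum_congr rfl fun t _ => ?_
  simp_rw [ite_mul, one_mul, zero_mul]
  rw [Finset.sum_ite_eq]
  simp

/-- `Σ_{e : P e} m(e) = #{t : P (edge t)}` (as a real sum of indicators). [folklore] -/
theorem sum_filter_walkWeight {n : ℕ} (edge : Fin n → E) (P : E → Prop) [DecidablePred P] :
    ∑ e ∈ univ.filter P, walkWeight edge e = ∑ t, if P (edge t) then (1 : ℝ) else 0 := by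
  rw [Finset.sum_filter]
  have h : ∀ e, (if P e then walkWeight edge e else 0) = walkWeight edge e * (if P e then (1 : ℝ) else 0) := by
    intro e; split_ifs <;> simp
  simp_rw [h]
  exact sum_walkWeight_mul edge (fun e => if P e then (1 : ℝ) else 0)

/-- **A cyclic walk is a circulation:** if `tgt (edge t) = src (edge (t+1))` cyclically, the multiplicity weight
has zero divergence (in-count = out-count at every vertex, by the cyclic shift `finRotate`). [folklore] -/
theorem isCirculation_walkWeight [Fintype V] [DecidableEq V] {src tgt : E → V} {n : ℕ} (edge : Fin n → E)
    (hchain : ∀ t, tgt (edge t) = src (edge (finRotate n t))) :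
    IsCirculation src tgt (walkWeight edge) where
  nonneg e := walkWeight_nonneg edge e
  divFree v := by
    rw [sum_filter_walkWeight, sum_filter_walkWeight]
    simp_rw [hchain]
    exact (Equiv.sum_comp (finRotate n) (fun t => if src (edge t) = v then (1 : ℝ) else 0)).symm

omit [Fintype E] in
/-- An injective walk uses every edge at most once: `m ≤ 1`. [folklore] -/
theorem walkWeight_le_one {n : ℕ} (edge : Fin n → E) (hinj : Function.Injective edge) (e : E) :
    walkWeight edge e ≤ 1 := by
  unfold walkWeight
  have h : (univ.filter fun t => edge t = e).card ≤ 1 :=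
    Finset.card_le_one.mpr fun a ha b hb =>
      hinj (((Finset.mem_filter.1 ha).2).trans ((Finset.mem_filter.1 hb).2).symm)
  exact_mod_cast h

omit [Fintype E] in
/-- A used edge lies on the walk. [folklore] -/
theorem exists_of_walkWeight_ne_zero {n : ℕ} (edge : Fin n → E) (e : E) (h : walkWeight edge e ≠ 0) :
    ∃ t, edge t = e := by
  unfold walkWeight at h
  have h' : (univ.filter fun t => edge t = e).card ≠ 0 := by exact_mod_cast h
  obtain ⟨t, ht⟩ := Finset.card_ne_zero.mp h'
  exact ⟨t, (Finset.mem_filter.1 ht).2⟩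

/-- Drive of a walk = sum of the edge drives along it. [folklore] -/
theorem drive_walkWeight {n : ℕ} (edge : Fin n → E) (s : E → ℝ) :
    drive s (walkWeight edge) = ∑ t, s (edge t) := sum_walkWeight_mul edge s

/-- Resistance of a walk = series resistance along it. [folklore] -/
theorem resistance_walkWeight {n : ℕ} (edge : Fin n → E) (c : E → ℝ) :
    resistance c (walkWeight edge) = ∑ t, 1 / c (edge t) := by
  unfold resistance
  simp_rw [div_eq_mul_one_div (walkWeight edge _)]
  exact sum_walkWeight_mul edge (fun e => 1 / c e)

end Summit.HubbardSuperconductivity.HubbardSuperconductivity.Theorems.AnisotropyChord.Stiffness.Loop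
/-! ## Part B — defect winding cycles on the torus and their loops -/
namespace Summit.HubbardSuperconductivity.HubbardSuperconductivity.Theorems.AnisotropyChord.Stiffness.Doob

variable {L : ℕ} [NeZero L]

/-- **A DEFECT WINDING CYCLE of axis `j`** (hypothesis-data of the converse rung N⁻, memo ROTOR-THEORY-10 §143):
a background configuration `base` and an injective closed nearest-neighbour walk `site : Fin n → (ℤ/L)²`
(step `t`: `site (t+1) = site t ± e_{dir t}`, sign `fwd t`) through sites that are EMPTY in `base`
(`base (site t) = 1`), winding once along axis `j`: the signed number of `j`-steps has square `≥ L²`.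
The defect is one extra particle placed on the cycle. [folklore] -/
structure DefectCycle (L : ℕ) [NeZero L] (j : Fin 2) where
  /-- length of the cycle -/
  n : ℕ
  /-- the background configuration (`1` = empty, `0` = particle) -/
  base : TensorIndex (TorusSite 2 L) 2
  /-- the sites of the cycle, in order -/
  site : Fin n → TorusSite 2 L
  /-- lattice direction of step `t` -/
  dir : Fin n → Fin 2
  /-- sign of step `t` (`true` = `+e_{dir t}`) -/
  fwd : Fin n → Bool
  /-- the cycle is simple -/
  site_inj : Function.Injective site
  /-- the cycle runs through empty sites of the background -/
  hole : ∀ t, base (site t) = 1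
  /-- consecutive sites differ by the signed unit step -/
  step : ∀ t, site (finRotate n t)
    = site t + (if fwd t then Pi.single (dir t) (1 : ZMod L) else -Pi.single (dir t) (1 : ZMod L))
  /-- one winding along axis `j` -/
  wind : (L : ℝ) ^ 2 ≤ (∑ t, if dir t = j then (if fwd t then (1 : ℝ) else -1) else 0) ^ 2

namespace DefectCycle

variable {j : Fin 2} (C : DefectCycle L j)

/-- The configuration with the defect at position `t` of the cycle: `base ∪ {site t}`. [folklore] -/
def config (t : Fin C.n) : TensorIndex (TorusSite 2 L) 2 := Function.update C.base (C.site t) 0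

/-- Lower endpoint of the directed bond crossed at step `t` (`site t` for a forward step, `site (t+1)` for a
backward one). [folklore] -/
def bondSite (t : Fin C.n) : TorusSite 2 L := if C.fwd t then C.site t else C.site (finRotate C.n t)

/-- The hop-edge of step `t`: bond `(bondSite t, dir t)`, source configuration `config t`. [folklore] -/
def edge (t : Fin C.n) : HopEdge L := ((C.bondSite t, C.dir t), C.config t)

/-- The loop of the cycle: multiplicity weight of its hop-edges. [folklore] -/
def loop : HopEdge L → ℝ := Loop.walkWeight C.edge

/-- Consecutive sites are distinct (`L ≥ 2`). [folklore] -/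
theorem site_succ_ne (hL : 2 ≤ L) (t : Fin C.n) : C.site (finRotate C.n t) ≠ C.site t := by
  intro h
  have hs := C.step t
  rw [h] at hs
  have h0 : (if C.fwd t then Pi.single (C.dir t) (1 : ZMod L) else -Pi.single (C.dir t) (1 : ZMod L))
      = (0 : TorusSite 2 L) := by
    have := congrArg (fun z => z - C.site t) hs
    simpa using this.symm
  have hne := torus_single_ne_zero (d := 2) hL (C.dir t)
  split_ifs at h0 with hf
  · exact hne h0
  · exact hne (neg_eq_zero.mp h0)

/-- The upper endpoint of the bond of step `t`. [folklore] -/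
theorem bondSite_add (t : Fin C.n) :
    C.bondSite t + Pi.single (C.dir t) 1 = if C.fwd t then C.site (finRotate C.n t) else C.site t := by
  unfold bondSite
  have hs := C.step t
  by_cases hf : C.fwd t = true
  · rw [if_pos hf] at hs; rw [if_pos hf, if_pos hf, hs]
  · rw [if_neg hf] at hs; rw [if_neg hf, if_neg hf, hs]; abel

/-- The defect sits at `site t`. [folklore] -/
theorem config_site (t : Fin C.n) : C.config t (C.site t) = 0 := by unfold config; simp

/-- Away from the defect the configuration is the background. [folklore] -/
theorem config_of_ne (t : Fin C.n) {z : TorusSite 2 L} (hz : z ≠ C.site t) : C.config t z = C.base z := by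
  unfold config; rw [Function.update_of_ne hz]

/-- The other cycle sites are empty in `config t`. [folklore] -/
theorem config_site_of_ne (t t' : Fin C.n) (h : t' ≠ t) : C.config t (C.site t') = 1 := by
  rw [C.config_of_ne t (fun he => h (C.site_inj he)), C.hole]

/-- `config` is injective (the defect position is read off the configuration). [folklore] -/
theorem config_injective : Function.Injective C.config := by
  intro t t' h
  by_contra hne
  have h1 := C.config_site t
  rw [h, C.config_site_of_ne t' t hne] at h1
  exact one_ne_zero h1

/-- `edge` is injective. [folklore] -/
theorem edge_injective : Function.Injective C.edge := fun _ _ h =>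
  C.config_injective (congrArg Prod.snd h)

/-- `finRotate t ≠ t` along the cycle (`L ≥ 2`). [folklore] -/
theorem finRotate_ne (hL : 2 ≤ L) (t : Fin C.n) : finRotate C.n t ≠ t := fun h =>
  C.site_succ_ne hL t (by rw [h])

/-- **Moving the defect one step is a single swap:** `config (t+1) = config t ∘ swap (site t) (site (t+1))`. [folklore] -/
theorem config_succ_eq_swap (hL : 2 ≤ L) (t : Fin C.n) :
    C.config (finRotate C.n t) = C.config t ∘ Equiv.swap (C.site t) (C.site (finRotate C.n t)) := by
  funext z
  simp only [Function.comp_apply]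
  have hne := C.site_succ_ne hL t
  by_cases h1 : z = C.site (finRotate C.n t)
  · rw [h1, Equiv.swap_apply_right, C.config_site, C.config_site]
  · by_cases h2 : z = C.site t
    · rw [h2, Equiv.swap_apply_left, C.config_site_of_ne _ _ (C.finRotate_ne hL t).symm,
        C.config_site_of_ne _ _ (C.finRotate_ne hL t)]
    · rw [Equiv.swap_apply_of_ne_of_ne h2 h1, C.config_of_ne _ h1, C.config_of_ne _ h2]

/-- Source of the hop-edge of step `t`. [folklore] -/
theorem hopSrc_edge (t : Fin C.n) : hopSrc (C.edge t) = C.config t := rfl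

/-- **Target of the hop-edge of step `t` is the next defect configuration.** [folklore] -/
theorem hopTgt_edge (hL : 2 ≤ L) (t : Fin C.n) : hopTgt (C.edge t) = C.config (finRotate C.n t) := by
  unfold hopTgt edge
  simp only
  rw [C.bondSite_add t, C.config_succ_eq_swap hL t]
  unfold bondSite
  by_cases hf : C.fwd t = true
  · rw [if_pos hf, if_pos hf]
  · rw [if_neg hf, if_neg hf, Equiv.swap_comm]

/-- The values of `config t` at the two endpoints of the bond of step `t`. [folklore] -/
theorem config_bond (hL : 2 ≤ L) (t : Fin C.n) :
    C.config t (C.bondSite t) = (if C.fwd t then 0 else 1) ∧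
      C.config t (C.bondSite t + Pi.single (C.dir t) 1) = (if C.fwd t then 1 else 0) := by
  rw [C.bondSite_add t]
  unfold bondSite
  by_cases hf : C.fwd t = true
  · rw [if_pos hf, if_pos hf, if_pos hf, if_pos hf]
    exact ⟨C.config_site t, C.config_site_of_ne _ _ (C.finRotate_ne hL t)⟩
  · rw [if_neg hf, if_neg hf, if_neg hf, if_neg hf]
    exact ⟨C.config_site_of_ne _ _ (C.finRotate_ne hL t), C.config_site t⟩

/-- The orientation of the hop of step `t` is its sign. [folklore] -/
theorem orient_edge (hL : 2 ≤ L) (t : Fin C.n) :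
    orient (C.bondSite t) (C.bondSite t + Pi.single (C.dir t) 1) (C.config t) = if C.fwd t then 1 else -1 := by
  obtain ⟨h1, h2⟩ := C.config_bond hL t
  unfold orient
  by_cases hf : C.fwd t = true
  · rw [if_pos hf] at h1 h2; rw [if_pos hf]; simp [h1, h2]
  · rw [if_neg hf] at h1 h2; rw [if_neg hf]; simp [h1, h2]

/-- The winding drive picked up at step `t`: `[dir t = j] · (±1)`. [folklore] -/
theorem hopDrive_edge (hL : 2 ≤ L) (t : Fin C.n) :
    hopDrive j (C.edge t) = if C.dir t = j then (if C.fwd t then (1 : ℝ) else -1) else 0 := by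
  unfold hopDrive edge
  simp only
  rw [C.orient_edge hL t]
  split_ifs <;> simp

/-- The Doob conductance of the hop-edge of step `t`: `¼ a(config t) a(config (t+1))` (the bond is flippable). [folklore] -/
theorem hopCond_edge (hL : 2 ≤ L) (a : TensorIndex (TorusSite 2 L) 2 → ℝ) (t : Fin C.n) :
    hopCond a (C.edge t) = (1 / 4 : ℝ) * (a (C.config t) * a (C.config (finRotate C.n t))) := by
  have hflip : (C.edge t).2 (C.edge t).1.1 ≠ (C.edge t).2 ((C.edge t).1.1 + Pi.single (C.edge t).1.2 1) := by
    obtain ⟨h1, h2⟩ := C.config_bond hL t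
    unfold edge; simp only
    rw [h1, h2]
    by_cases hf : C.fwd t = true
    · rw [if_pos hf, if_pos hf]; exact zero_ne_one
    · rw [if_neg hf, if_neg hf]; exact one_ne_zero
  unfold hopCond
  rw [if_pos hflip, C.hopTgt_edge hL t]
  rfl

/-- **(L1a) The loop of a defect winding cycle is a circulation.** [folklore] -/
theorem loop_isCirculation (hL : 2 ≤ L) : Loop.IsCirculation hopSrc hopTgt C.loop :=
  Loop.isCirculation_walkWeight C.edge fun t => by rw [C.hopTgt_edge hL t, C.hopSrc_edge]

/-- (L1b) The loop uses every hop-edge at most once. [folklore] -/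
theorem loop_le_one (e : HopEdge L) : C.loop e ≤ 1 := Loop.walkWeight_le_one C.edge C.edge_injective e

/-- (L1c) The loop only uses hop-edges of positive Doob conductance when `a > 0` along the cycle. [folklore] -/
theorem loop_cond_pos (hL : 2 ≤ L) (a : TensorIndex (TorusSite 2 L) 2 → ℝ) (hpos : ∀ t, 0 < a (C.config t))
    (e : HopEdge L) (he : 0 < C.loop e) : 0 < hopCond a e := by
  obtain ⟨t, rfl⟩ := Loop.exists_of_walkWeight_ne_zero C.edge e he.ne'
  rw [C.hopCond_edge hL a t]
  exact mul_pos (by norm_num) (mul_pos (hpos _) (hpos _))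

/-- (L1d) The loop carries the winding drive `Σ_t [dir t = j]·(±1)`. [folklore] -/
theorem drive_loop (hL : 2 ≤ L) :
    Loop.drive (hopDrive j) C.loop = ∑ t, if C.dir t = j then (if C.fwd t then (1 : ℝ) else -1) else 0 := by
  unfold loop
  rw [Loop.drive_walkWeight]
  exact Finset.sum_congr rfl fun t _ => C.hopDrive_edge hL t

/-- (L1d′) One winding: `drive² ≥ L²`. [folklore] -/
theorem drive_loop_sq_ge (hL : 2 ≤ L) : (L : ℝ) ^ 2 ≤ Loop.drive (hopDrive j) C.loop ^ 2 := by
  rw [C.drive_loop hL]; exact C.wind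

/-- (L1e) The resistance of the loop: `Σ_t 4/(a(config t) a(config (t+1)))`. [folklore] -/
theorem resistance_loop (hL : 2 ≤ L) (a : TensorIndex (TorusSite 2 L) 2 → ℝ) :
    Loop.resistance (hopCond a) C.loop = ∑ t, 4 / (a (C.config t) * a (C.config (finRotate C.n t))) := by
  unfold loop
  rw [Loop.resistance_walkWeight]
  refine Finset.sum_congr rfl fun t _ => ?_
  rw [C.hopCond_edge hL a t]
  have hx : (1 / 4 : ℝ) * (a (C.config t) * a (C.config (finRotate C.n t))) ≠ 0 ∨
      (1 / 4 : ℝ) * (a (C.config t) * a (C.config (finRotate C.n t))) = 0 := (em _).symm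
  rcases hx with hx | hx
  · field_simp
  · rw [hx]
    have : a (C.config t) * a (C.config (finRotate C.n t)) = 0 := by linarith
    rw [this]; simp

/-- The cycle is non-empty (`n ≥ 1`): an empty walk cannot wind. [folklore] -/
theorem n_pos : 0 < C.n := by
  by_contra h
  have hn : C.n = 0 := by omega
  have hw := C.wind
  have hsum : (∑ t : Fin C.n, if C.dir t = j then (if C.fwd t then (1 : ℝ) else -1) else 0) = 0 := by
    have : IsEmpty (Fin C.n) := by rw [hn]; infer_instance
    exact Finset.sum_eq_zero fun t _ => (IsEmpty.false t).elim
  rw [hsum] at hw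
  have hL : (0 : ℝ) < (L : ℝ) := by exact_mod_cast Nat.pos_of_ne_zero (NeZero.ne L)
  nlinarith

/-- (L1f) The resistance of the loop is positive when `a > 0` along the cycle. [folklore] -/
theorem resistance_loop_pos (hL : 2 ≤ L) (a : TensorIndex (TorusSite 2 L) 2 → ℝ)
    (hpos : ∀ t, 0 < a (C.config t)) : 0 < Loop.resistance (hopCond a) C.loop := by
  rw [C.resistance_loop hL a]
  have hne : (Finset.univ : Finset (Fin C.n)).Nonempty :=
    Finset.univ_nonempty_iff.mpr ⟨⟨0, C.n_pos⟩⟩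
  exact Finset.sum_pos (fun t _ => div_pos (by norm_num) (mul_pos (hpos _) (hpos _))) hne

/-- **(L1g) FLATNESS ⇒ RESISTANCE BOUND:** if the defect amplitude profile along the cycle is flat on average
relative to the starter `s`, `Σ_t (a(config s)/a(config t))² ≤ n·B²`, then `a(config s)² · R(loop) ≤ 4 n B²`
(`4/(xy) ≤ 2/x² + 2/y²` per step, each cycle configuration appears in two steps). [folklore] -/
theorem sq_mul_resistance_loop_le (hL : 2 ≤ L) (a : TensorIndex (TorusSite 2 L) 2 → ℝ)
    (hpos : ∀ t, 0 < a (C.config t)) (s : Fin C.n) (B : ℝ)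
    (hflat : ∑ t, (a (C.config s) / a (C.config t)) ^ 2 ≤ (C.n : ℝ) * B ^ 2) :
    a (C.config s) ^ 2 * Loop.resistance (hopCond a) C.loop ≤ 4 * (C.n : ℝ) * B ^ 2 := by
  rw [C.resistance_loop hL a, Finset.mul_sum]
  set r : Fin C.n → ℝ := fun t => (a (C.config s) / a (C.config t)) ^ 2 with hr
  have hstep : ∀ t, a (C.config s) ^ 2 * (4 / (a (C.config t) * a (C.config (finRotate C.n t))))
      ≤ 2 * r t + 2 * r (finRotate C.n t) := by
    intro t
    have hx := hpos t
    have hy := hpos (finRotate C.n t)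
    simp only [hr]
    rw [div_pow, div_pow]
    have key : 4 / (a (C.config t) * a (C.config (finRotate C.n t)))
        ≤ 2 / a (C.config t) ^ 2 + 2 / a (C.config (finRotate C.n t)) ^ 2 := by
      rw [div_add_div _ _ (by positivity) (by positivity), div_le_div_iff₀ (by positivity) (by positivity)]
      nlinarith [sq_nonneg (a (C.config t) - a (C.config (finRotate C.n t))), mul_pos hx hy,
        mul_pos (mul_pos hx hy) (mul_pos hx hy)]
    have h2 := mul_le_mul_of_nonneg_left key (sq_nonneg (a (C.config s)))
    calc a (C.config s) ^ 2 * (4 / (a (C.config t) * a (C.config (finRotate C.n t))))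
        ≤ a (C.config s) ^ 2 * (2 / a (C.config t) ^ 2 + 2 / a (C.config (finRotate C.n t)) ^ 2) := h2
      _ = 2 * (a (C.config s) ^ 2 / a (C.config t) ^ 2)
          + 2 * (a (C.config s) ^ 2 / a (C.config (finRotate C.n t)) ^ 2) := by ring
  calc ∑ t, a (C.config s) ^ 2 * (4 / (a (C.config t) * a (C.config (finRotate C.n t))))
      ≤ ∑ t, (2 * r t + 2 * r (finRotate C.n t)) := Finset.sum_le_sum fun t _ => hstep t
    _ = 2 * ∑ t, r t + 2 * ∑ t, r (finRotate C.n t) := by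
        rw [Finset.sum_add_distrib, Finset.mul_sum, Finset.mul_sum]
    _ = 4 * ∑ t, r t := by
        rw [Equiv.sum_comp (finRotate C.n) r]; ring
    _ ≤ 4 * ((C.n : ℝ) * B ^ 2) := by
        have := hflat; simp only [hr] at this ⊢; nlinarith
    _ = 4 * (C.n : ℝ) * B ^ 2 := by ring

/-! ### (L2) A hop-edge determines the defect and the background -/
/-- The moving site of a hop-edge: the endpoint of the bond that carries the particle. [folklore] -/
def mover (e : HopEdge L) : TorusSite 2 L := if e.2 e.1.1 = 0 then e.1.1 else e.1.1 + Pi.single e.1.2 1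

/-- The mover of the hop-edge of step `t` is the defect site `site t`. [folklore] -/
theorem mover_edge (hL : 2 ≤ L) (t : Fin C.n) : mover (C.edge t) = C.site t := by
  obtain ⟨h1, -⟩ := C.config_bond hL t
  unfold mover
  have he1 : (C.edge t).2 (C.edge t).1.1 = C.config t (C.bondSite t) := rfl
  rw [he1, h1]
  show (if (if C.fwd t then (0 : Fin 2) else 1) = 0 then C.bondSite t else C.bondSite t + Pi.single (C.dir t) 1)
    = C.site t
  by_cases hf : C.fwd t = true
  · rw [if_pos hf, if_pos rfl]; unfold bondSite; rw [if_pos hf]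
  · rw [if_neg hf, if_neg (by decide), C.bondSite_add t, if_neg hf]

/-- The background is recovered from the hop-edge: `base = update (src e) (mover e) 1`. [folklore] -/
theorem base_eq_of_edge (hL : 2 ≤ L) (t : Fin C.n) :
    C.base = Function.update (hopSrc (C.edge t)) (mover (C.edge t)) 1 := by
  rw [C.mover_edge hL t, C.hopSrc_edge]
  unfold config
  rw [Function.update_idem, eq_comm]
  exact Function.update_eq_self_iff.mpr (C.hole t).symm

end DefectCycle

end Summit.HubbardSuperconductivity.HubbardSuperconductivity.Theorems.AnisotropyChord.Stiffness.Doob
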